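import Summits.QuantumFields.YangMills.Theorems.BalabanUVNodesN18AtReadingOnTables

/-!
# BalabanUVNodes ∕ node N18 = NE5 — N18 AT node00-def-W1's GENERATED TABLES: a transport-closed table family containing the strictly small fields contains
# their averaging-closure, so N18 at such a family gives N18 at the generated reading `ReadingData.ofRecordGen`; closed forms of N18's statement there
# (Track A, DAG node N18 = `T4OutputRate.NE5` :211; cluster K4 «SpineRates»; module 16a of seat pub-ymgap-dag-n18-d, strategy s2)

HONEST FRAMING.  Count-neutral kernel bookkeeping (`--supports … --as helper`), composition BY NAME of landed theorems; NE5 is NOT PRINTED and NOT proved;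
N18 is NOT discharged; no inhabitant of `IsDatumOfRecord₁₂C` is claimed (K0′).

WHY.  node00-def-W1 g4's `Node00/RateRecordW1MapsAdm` §4 typed the GENERATED tables `spGen F M N Pplus T₀` — at slot `k` the image in `Φ` of the averaging-closure
`AvGen Pplus T₀ k` of the strictly small fields `Pplus` under the one-step transports `T₀` ([I] p. 262 (iv) «all the averages `M^n(U)`»; King's nesting (3.40)–(3.42))
— on which the transport clause `hT₀` of the admissible reading is a constructor (`hT₀_spGen`), with ONE displayed Bałaban clause left: `hunif` (generated form) ∕
`horig` (origin form, [I] p. 263 L9–13: the `a`-fold averages of strictly small fields stay in the table, uniformly in `a`; unproved there).  THIS FILE proves that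
clause for ANY table family `sp` closed under the transports (module 12's clause `hT`) and containing the strictly small fields (`hstrict`): by induction on the
closure the generated fields are read inside `sp` (§1), so `spGen ⊆ sp` entrywise and module 12's antitone transfer moves N18 from the admissible reading on `sp` to
the generated reading (§2); §2 also displays N18's statement at the generated reading in closed form, in generated and in origin form.  Module 16b
(`…N18AtPlaqEnvelopeTables`) instantiates at the plaquette-envelope tables of dag-n18-e's module 11 with the transport of record.

WHAT (all `theorem`, 0 `def`).  §1: `avGen_mem_of_admTransport` (generated ⇒ read inside every transport-closed family containing the strict fields),
`spGen_subset_of_admTransport`, `avIter_mem_of_admTransport` (iterated transports keep the tables), `horig_of_admTransport` (W1's clause `horig` for such a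
family).  §2: ★ `s_N18_readingGen₁₂_iff` (N18's statement at the GENERATED reading in closed form: the η-rate inequality for every generated run-B field),
`s_N18_readingGen₁₂_iff_origin` (the same over all `a`-fold averages of strictly small fields — the print's (iv) form), ★ `s_N18_readingGen₁₂_of_readingAdm` (N18 at a
transport-closed family containing the strict fields ⇒ N18 at the generated reading), `admBg_spGen_nonempty_of_strict` (non-vacuity hook).

One finite four-torus programme at fixed `ε`; NOT the continuum limit, NOT OS, NOT a mass gap, NOT Clay.  0 `def`, 0 `sorry`.  Sources (TYPES only): T. Bałaban,
CMP **109** (1987) [Balaban1987RG1] (0.21)–(0.25) pp. 256–257, Thm 1 p. 259, (1.11)–(1.16) p. 262, p. 263 L5–21 and (1.18); CMP **116** (1988)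
[Balaban1988RG2Cluster] (2.13) p. 14; C. King, CMP **103** (1986) [King1986] (3.40)–(3.42) p. 660.
-/

noncomputable section

open Set Metric
open scoped Matrix.Norms.L2Operator

namespace YMDAG.N18.W1Reading

open Literature.MathematicalPhysics.QuantumFieldTheory.Balaban1983to89
open Literature.MathematicalPhysics.QuantumFieldTheory.Balaban1983to89.T4Continuum
open Literature.MathematicalPhysics.QuantumFieldTheory.Balaban1983to89.T4OutputRate (Window)
open Literature.MathematicalPhysics.QuantumFieldTheory.Balaban1983to89.Node00 (Stage12Params IsDatumOfRecord₁₂C NE2Objects₁₁ NE3Letters₁₁ prependCoupling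
  MatA ιSU avOfRecord)
open Literature.MathematicalPhysics.QuantumFieldTheory.Balaban1983to89.Node00.Sect2 (domSys CPair ofBackgroundC cubeDom)
open Literature.MathematicalPhysics.QuantumFieldTheory.Balaban1983to89.Node00.W1 (ReadingData LevelPairing LetterInputs ClusterTower pairOfRecord functionalC AdmBg
  AvGen avIter spGen mem_spGen_iff hT₀_spGen spGen_subset_of_hunif avGen_of_origin avGen_iff_origin)
open Summit.QuantumFields.BalabanUV.T4Continuum.B13Carriers (transportRaw)
open Summit.QuantumFields.BalabanUV.T4Continuum.Spine.NE5
open YMDAG.N18.HLayer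
open YMDAG.UVSplit

variable {N : ℕ} [NeZero N]

/-! ## §1 Generic: a transport-closed table family containing the strictly small fields contains the generated family -/

section GeneratedTables

variable {F : T4Family} {M : ℕ}
  (Pplus : (k : ℕ) → GaugeField (F.P k) 0 (Node00.SU N) → Prop)
  (T₀ : (k : ℕ) → GaugeField (F.P (k + 1)) 0 (Node00.SU N) → GaugeField (F.P k) 0 (Node00.SU N))
  {sp : (k j : ℕ) → (domSys (F.P k) M j).Dom → Set (CPair (F.P k) (MatA N))}
  (hstrict : ∀ (k : ℕ) (U : GaugeField (F.P k) 0 (Node00.SU N)), Pplus k U →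
    ∀ (j : ℕ) (Y : (domSys (F.P k) M j).Dom), ofBackgroundC (ιSU N) U ∈ sp k j Y)
  (hT : ∀ (k : ℕ) (U : GaugeField (F.P (k + 1)) 0 (Node00.SU N)),
    (∀ (j : ℕ) (Y : (domSys (F.P (k + 1)) M j).Dom), ofBackgroundC (ιSU N) U ∈ sp (k + 1) j Y) →
      ∀ (j : ℕ) (X : (domSys (F.P k) M j).Dom), ofBackgroundC (ιSU N) (T₀ k U) ∈ sp k j X)

omit [NeZero N] in
include hstrict hT in
/-- **GENERATED BACKGROUNDS ARE READ INSIDE EVERY TRANSPORT-CLOSED TABLE FAMILY CONTAINING THE STRICTLY SMALL FIELDS** — node00-def-W1's displayed clause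
`hunif` PROVED for such a family (induction on the closure `AvGen`: a strict field is in the table by `hstrict`, a transport of a generated field by `hT`).
[cite: Balaban1987RG1, p.262 (iv) and p.263 L5-13; King1986, (3.40)-(3.42) p.660] -/
theorem avGen_mem_of_admTransport {k : ℕ} {U : GaugeField (F.P k) 0 (Node00.SU N)} (h : AvGen Pplus T₀ k U) :
    ∀ (j : ℕ) (Y : (domSys (F.P k) M j).Dom), ofBackgroundC (ιSU N) U ∈ sp k j Y :=
  AvGen.rec (motive := fun k (U : GaugeField (F.P k) 0 (Node00.SU N)) _ => ∀ (j : ℕ) (Y : (domSys (F.P k) M j).Dom), ofBackgroundC (ιSU N) U ∈ sp k j Y)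
    (fun h => hstrict _ _ h) (fun _ ih => hT _ _ ih) h

omit [NeZero N] in
include hstrict hT in
/-- **THE GENERATED TABLES LIE INSIDE EVERY TRANSPORT-CLOSED TABLE FAMILY CONTAINING THE STRICTLY SMALL FIELDS**, entrywise (W1's `spGen_subset_of_hunif` with
`hunif` := `avGen_mem_of_admTransport`) — what module 12's antitone transfer of N18 between table families consumes.
[cite: Balaban1987RG1, p.262 (iv), (1.15)-(1.16) and p.263 L5-13] -/
theorem spGen_subset_of_admTransport (k j : ℕ) (Y : (domSys (F.P k) M j).Dom) : spGen F M N Pplus T₀ k j Y ⊆ sp k j Y :=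
  spGen_subset_of_hunif (F := F) (M := M) (N := N) (Pplus := Pplus) (T₀ := T₀)
    (fun _ _ hU => avGen_mem_of_admTransport Pplus T₀ hstrict hT hU) k j Y

omit [NeZero N] in
include hT in
/-- **ITERATED TRANSPORTS KEEP THE TABLES** (origin form, `M^a` of [I] p.263 L9 = W1's top-first iterate `avIter`): a field of the `(k+a)`-th torus read inside the
level-`(k+a)` tables has its `a`-fold transport read inside the level-`k` tables — for EVERY `a`, by `a` applications of the one-step clause `hT`.
[cite: Balaban1987RG1, p.263 L9-13 (M^n(U) = U^n; bookkeeping)] -/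
theorem avIter_mem_of_admTransport (k : ℕ) : ∀ (a : ℕ) (U : GaugeField (F.P (k + a)) 0 (Node00.SU N)),
    (∀ (j : ℕ) (Y : (domSys (F.P (k + a)) M j).Dom), ofBackgroundC (ιSU N) U ∈ sp (k + a) j Y) →
      ∀ (j : ℕ) (X : (domSys (F.P k) M j).Dom),
        ofBackgroundC (ιSU N) (avIter (Bk := fun k => GaugeField (F.P k) 0 (Node00.SU N)) T₀ k a U) ∈ sp k j X
  | 0, _, hU => hU
  | a + 1, U, hU => avIter_mem_of_admTransport k a (T₀ (k + a) U) (hT (k + a) U hU)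

omit [NeZero N] in
include hstrict hT in
/-- **node00-def-W1's CLAUSE `horig` FOR A TRANSPORT-CLOSED FAMILY CONTAINING THE STRICTLY SMALL FIELDS**: the `a`-fold transport of a strictly small field of
the `(k+a)`-th torus is read inside the level-`k` tables, uniformly in `a` (the shape `W1.spGen_subset_of_origin` consumes).
[cite: Balaban1987RG1, p.263 L9-13; King1986, (3.41)-(3.42) p.660] -/
theorem horig_of_admTransport (k a : ℕ) (U₀ : GaugeField (F.P (k + a)) 0 (Node00.SU N)) (h₀ : Pplus (k + a) U₀)
    (j : ℕ) (Y : (domSys (F.P k) M j).Dom) :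
    ofBackgroundC (ιSU N) (avIter (Bk := fun k => GaugeField (F.P k) 0 (Node00.SU N)) T₀ k a U₀) ∈ sp k j Y :=
  avIter_mem_of_admTransport T₀ hT k a U₀ (hstrict _ _ h₀) j Y

end GeneratedTables

/-! ## §2 Generic: N18's statement at the GENERATED reading — closed forms and the transfer from a transport-closed family -/

section GeneratedReading

variable (S : (F : T4Family) → (θ : Stage12Params F N) → (k : ℕ) → ClusterTower (F.P k) (MatA N) θ.τ9.M)
  (Pplus : (F : T4Family) → (θ : Stage12Params F N) → (k : ℕ) → GaugeField (F.P k) 0 (Node00.SU N) → Prop)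
  (sp : (F : T4Family) → (θ : Stage12Params F N) → (k j : ℕ) → (domSys (F.P k) θ.τ9.M j).Dom → Set (CPair (F.P k) (MatA N)))
  (gauge : (F : T4Family) → (θ : Stage12Params F N) → (k : ℕ) → GaugeField (F.P k) 0 (Node00.SU N) → GaugeField (F.P k) 0 (Node00.SU N) → ℝ)
  (hg : ∀ (F : T4Family) (θ : Stage12Params F N) (k : ℕ) (U U' : GaugeField (F.P k) 0 (Node00.SU N)), 0 ≤ gauge F θ k U U')
  (T₀ : (F : T4Family) → (θ : Stage12Params F N) → (k : ℕ) → GaugeField (F.P (k + 1)) 0 (Node00.SU N) → GaugeField (F.P k) 0 (Node00.SU N))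
  (hT : ∀ (F : T4Family) (θ : Stage12Params F N) (k : ℕ) (U : GaugeField (F.P (k + 1)) 0 (Node00.SU N)),
    (∀ (j : ℕ) (Y : (domSys (F.P (k + 1)) θ.τ9.M j).Dom), ofBackgroundC (ιSU N) U ∈ sp F θ (k + 1) j Y) →
      ∀ (j : ℕ) (X : (domSys (F.P k) θ.τ9.M j).Dom), ofBackgroundC (ιSU N) (T₀ F θ k U) ∈ sp F θ k j X)
  (li : (F : T4Family) → Stage12Params F N → LetterInputs) (ℓ₃ : T4Family → NE3Letters₁₁)
  (ne2 : (F : T4Family) → Stage12Params F N → (ℕ → ℝ) → List (ULoop F) → ℕ → NE2Objects₁₁)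
  (ne1 : (F : T4Family) → Stage12Params F N → (ℕ → ℝ) → List (ULoop F) → NE1pCarriers)

/-- **N18's STATEMENT AT THE GENERATED READING, IN CLOSED FORM** [bookkeeping; module 12 §2 `s_N18_readingAdm₁₂_iff` at `sp := spGen …`, `hT := hT₀_spGen …` (W1's
`ReadingData.ofRecordGen` IS that admissible reading, `rfl`) + `mem_spGen_iff`]: `S_N18 (RRec₁₂ 𝔯_gen)` ⇔ for every family `F`, datum key `h` (`θ := h.params`), run
length `k`, member `b ∈ ]0, θ.γ]`, history `g ∈ ]0, θ.γ]^ℕ`, every GENERATED run-B field `U` of the `(k+1)`-th torus (`AvGen (Pplus F θ) (T₀ F θ) (k+1) U`: in the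
averaging-closure of the strictly small fields) and every run-A domain `(j, X)`:
`|Re E^{(j)}_{S_k}(X; g; (ι(T₀ U), 0)) − Re E^{(j+1)}_{S_{k+1}}(πX; b∷g; (ιU, 0))| ≤ C₅ · θ₅ ^ j · e^{−κ·d_j(X)}`.  NOT PRINTED; NOT proved.
[cite: Balaban1987RG1, Thm 1 p.259, p.262 (iv), p.263 L5-13 and (1.18) p.263; Balaban1988RG2Cluster, (2.13) p.14] -/
theorem s_N18_readingGen₁₂_iff :
    S_N18 (RRec₁₂ (readingOfRecord₁₂ (fun F θ => ReadingData.ofRecordGen F θ.τ9.M N (Pplus F θ) (T₀ F θ) (S F θ) (gauge F θ) (hg F θ) (li F θ))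
      ℓ₃ ne2 ne1)) ↔
      ∀ (F : T4Family) (D : Datum F N) (h : IsDatumOfRecord₁₂C F N D) (k : ℕ) (b : ℝ), 0 < b → b ≤ h.params.γ →
        ∀ g ∈ Window h.params.γ, ∀ (U : GaugeField (F.P (k + 1)) 0 (Node00.SU N)), AvGen (Pplus F h.params) (T₀ F h.params) (k + 1) U →
          ∀ X : Node00.W1.Dom (F.P k) h.params.τ9.M,
          |(functionalC (S F h.params k) g (ofBackgroundC (ιSU N) (T₀ F h.params k U)) X).re -
              (functionalC (S F h.params (k + 1)) (prependCoupling b g) (ofBackgroundC (ιSU N) U) (pairOfRecord F h.params.τ9.M k X)).re| ≤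
            (li F h.params).C₅ * (li F h.params).θ₅ ^ X.1 * Real.exp (-((li F h.params).κ * (domSys (F.P k) h.params.τ9.M X.1).dj X.2)) := by
  refine (s_N18_readingAdm₁₂_iff S (fun F θ => spGen F θ.τ9.M N (Pplus F θ) (T₀ F θ)) gauge hg T₀
    (fun F θ => hT₀_spGen F θ.τ9.M N (Pplus F θ) (T₀ F θ)) li ℓ₃ ne2 ne1).trans ?_
  refine forall₅_congr fun F D h k b => forall₂_congr fun hb hbγ => forall₂_congr fun g hgW => ⟨fun H U hU X => ?_, fun H U X => ?_⟩
  · exact H ⟨U, fun j Y => (mem_spGen_iff Y U).2 hU⟩ X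
  · exact H U.1 ((mem_spGen_iff (cubeDom (F.P (k + 1)) h.params.τ9.M 0 fun _ => 0) U.1).1 (U.2 0 _)) X

/-- **THE SAME IN THE PRINT's ORIGIN FORM** [bookkeeping; `avGen_iff_origin`]: N18 at the generated reading ⇔ the η-rate inequality for every `a`-FOLD TRANSPORT
`U = avIter T₀ (k+1) a U₀` of a strictly small field `U₀` of the `(k+1+a)`-th torus (`Pplus … (k+1+a) U₀`), EVERY `a` — [I] p.262 (iv) «all the averages `M^n(U)`».
[cite: Balaban1987RG1, p.262 (iv), p.263 L9-13 and (1.18) p.263; Balaban1988RG2Cluster, (2.13) p.14] -/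
theorem s_N18_readingGen₁₂_iff_origin :
    S_N18 (RRec₁₂ (readingOfRecord₁₂ (fun F θ => ReadingData.ofRecordGen F θ.τ9.M N (Pplus F θ) (T₀ F θ) (S F θ) (gauge F θ) (hg F θ) (li F θ))
      ℓ₃ ne2 ne1)) ↔
      ∀ (F : T4Family) (D : Datum F N) (h : IsDatumOfRecord₁₂C F N D) (k : ℕ) (b : ℝ), 0 < b → b ≤ h.params.γ →
        ∀ g ∈ Window h.params.γ, ∀ (a : ℕ) (U₀ : GaugeField (F.P (k + 1 + a)) 0 (Node00.SU N)), Pplus F h.params (k + 1 + a) U₀ →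
          ∀ X : Node00.W1.Dom (F.P k) h.params.τ9.M,
          |(functionalC (S F h.params k) g (ofBackgroundC (ιSU N) (T₀ F h.params k
                (avIter (Bk := fun k => GaugeField (F.P k) 0 (Node00.SU N)) (T₀ F h.params) (k + 1) a U₀))) X).re -
              (functionalC (S F h.params (k + 1)) (prependCoupling b g)
                (ofBackgroundC (ιSU N) (avIter (Bk := fun k => GaugeField (F.P k) 0 (Node00.SU N)) (T₀ F h.params) (k + 1) a U₀))
                (pairOfRecord F h.params.τ9.M k X)).re| ≤
            (li F h.params).C₅ * (li F h.params).θ₅ ^ X.1 * Real.exp (-((li F h.params).κ * (domSys (F.P k) h.params.τ9.M X.1).dj X.2)) := by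
  rw [s_N18_readingGen₁₂_iff]
  refine forall₅_congr fun F D h k b => forall₂_congr fun hb hbγ => forall₂_congr fun g hgW => ⟨fun H a U₀ h₀ X => ?_, fun H U hU X => ?_⟩
  · exact H _ (avGen_of_origin (Pplus F h.params) (T₀ F h.params) h₀) X
  · obtain ⟨a, U₀, h₀, rfl⟩ := (avGen_iff_origin (Pplus F h.params) (T₀ F h.params)).1 hU
    exact H a U₀ h₀ X

/-- **N18 AT A TRANSPORT-CLOSED TABLE FAMILY CONTAINING THE STRICTLY SMALL FIELDS ⇒ N18 AT THE GENERATED READING** [bookkeeping; module 12 §4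
`s_N18_readingAdm₁₂_antitone` with §1's inclusion `spGen_subset_of_admTransport`]: same towers, gauges, transports and letters.
[cite: Balaban1987RG1, Thm 1 p.259, p.262 (iv), p.263 L5-13 and (1.18) p.263] -/
theorem s_N18_readingGen₁₂_of_readingAdm
    (hstrict : ∀ (F : T4Family) (θ : Stage12Params F N) (k : ℕ) (U : GaugeField (F.P k) 0 (Node00.SU N)), Pplus F θ k U →
      ∀ (j : ℕ) (Y : (domSys (F.P k) θ.τ9.M j).Dom), ofBackgroundC (ιSU N) U ∈ sp F θ k j Y)
    (hS : S_N18 (RRec₁₂ (readingOfRecord₁₂ (fun F θ => ReadingData.ofRecordAdm F θ.τ9.M N (S F θ) (sp F θ) (gauge F θ) (hg F θ) (T₀ F θ) (hT F θ) (li F θ))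
      ℓ₃ ne2 ne1))) :
    S_N18 (RRec₁₂ (readingOfRecord₁₂ (fun F θ => ReadingData.ofRecordGen F θ.τ9.M N (Pplus F θ) (T₀ F θ) (S F θ) (gauge F θ) (hg F θ) (li F θ))
      ℓ₃ ne2 ne1)) :=
  s_N18_readingAdm₁₂_antitone S (fun F θ => spGen F θ.τ9.M N (Pplus F θ) (T₀ F θ)) gauge hg T₀
    (fun F θ => hT₀_spGen F θ.τ9.M N (Pplus F θ) (T₀ F θ)) li ℓ₃ ne2 ne1 sp hT
    (fun F θ k j X => spGen_subset_of_admTransport (Pplus F θ) (T₀ F θ) (hstrict F θ) (hT F θ) k j X) hS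

/-- **NON-VACUITY AT THE GENERATED READING** (A1 display, W1's hook `AdmBg.nonempty_spGen_of_strict`): wherever a strictly small field exists at level `k` — e.g. the
unit configuration `U ≡ 1` for plaquette smallness with a positive threshold (§3) — the run backgrounds of the generated reading at slot `k` are INHABITED.
[cite: Balaban1987RG1, p.263 L19-21 (bookkeeping; non-vacuity)] -/
theorem admBg_spGen_nonempty_of_strict (F : T4Family) (θ : Stage12Params F N) (k : ℕ) (U : GaugeField (F.P k) 0 (Node00.SU N))
    (h : Pplus F θ k U) : Nonempty (AdmBg F θ.τ9.M N (spGen F θ.τ9.M N (Pplus F θ) (T₀ F θ)) k) :=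
  AdmBg.nonempty_spGen_of_strict (M := θ.τ9.M) U h

end GeneratedReading

end YMDAG.N18.W1Reading

end
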